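import Literature.AlgebraicGeometry.Resolution.NeronPopescuLiftingCharts
import Literature.AlgebraicGeometry.Resolution.NeronPopescuLiftingRelations
import Literature.AlgebraicGeometry.Resolution.NeronPopescuLiftingAlgebra
import HarnessLib

/-!
# Stacks 07CP (the lifting lemma), general case — III. Assembly

Topic: `Literature/AlgebraicGeometry/Resolution`. The Stacks Project, *Smoothing Ring Maps*
(Tag 07BW), §"The lifting lemma":
> **Lemma 07CP.** Let `R` be a Noetherian ring. Let `Λ` be an `R`-algebra. Let `π ∈ R` and
> assume that `Ann_R(π) = Ann_R(π²)` and `Ann_Λ(π) = Ann_Λ(π²)`. Suppose we have `R`-algebra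
> maps `R/π²R → C̄ → Λ/π²Λ` with `C̄` of finite presentation. Then there exists an `R`-algebra
> homomorphism `D → Λ` and a commutative diagram … with the following properties:
> (a) `D` is of finite presentation, (b) `R → D` is smooth at any prime `𝔮` with `π ∉ 𝔮`,
> (c) `R → D` is smooth at any prime `𝔮` with `π ∈ 𝔮` lying over a prime of `C̄` where
> `R/π²R → C̄` is smooth, (d) `C̄/πC̄ → D/πD` is smooth at any prime lying over a prime of `C̄`
> where `R/π²R → C̄` is smooth.
`Stacks07CP_general` PROVES (a), (b), (c) for an arbitrary finitely presented `C̄` (the case needed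
by Lemma 07F0 and hence by Lemmas 07F8/07FE; the smooth case with a global conclusion is
`Stacks07CP_of_smooth`, `NeronPopescuLiftingLemma.lean`). Rendering: (b) as `π ∈ H_{D/R}`
(`singularIdeal`, Stacks 07C5: `D_π` smooth), and (c) — equivalently, since `H_{D/R}` is a
radical ideal containing `π` — as "every lift to `D` of `ε(x)`, for `x ∈ C̄` with `C̄_x` smooth
over `R/π²R`, lies in `H_{D/R}`". (d) is not formalised.
This file chooses the data of the printed proof — a presentation `P₀` of `C̄` over `R`, the
finitely many charts `a_k` covering the smooth locus with `(Ī/Ī²)_{a_k}` free on relations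
`b̃_{k,i}` (`Stacks07CP.exists_finite_charts`), the lifted relations (4)
(`Stacks07CP.exists_lift_relations`), normalised, and (5) (`h5N`, from the coefficient comparison
`Stacks07CP.exists_pow_mul_eq_zero_of_sum_eq_zero`) — feeds them to the algebra `D` of
`NeronPopescuLiftingAlgebra.lean`, and runs the final prime-by-prime argument of the printed
proof (`mem_singularIdeal_of_eps`: a prime `𝔮 ∋ π` of `D` over the smooth locus of `C̄` misses
some `a_k` and then some maximal minor of `(∂b̃_{k,j}/∂x_i)`, by Lemma 07DQ (2) applied to a
left inverse of the split injection `(Ī/Ī²)_{a_k} → ⊕ C̄_{a_k} dx_i`,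
`Stacks07EZ.exists_matrix_mul_jacobian`). No named facts.

## References

* The Stacks Project, *Smoothing Ring Maps* (Tag 07BW), Lemma 07CP and its proof; Lemma 07C6;
  Algebra, Lemma 07DQ. [StacksProject]
-/

noncomputable section

open MvPolynomial TensorProduct

namespace Literature.AlgebraicGeometry.Resolution

namespace Stacks07CPGen

universe u

section Setup

variable {R : Type u} [CommRing R] (π : R) (R' : Type u) [CommRing R'] [Algebra R R']

variable {Cb : Type u} [CommRing Cb] [Algebra R Cb] [Algebra R' Cb] [IsScalarTower R R' Cb]
  {n m₀ : ℕ} (P₀ : Algebra.Presentation R Cb (Fin n) (Fin m₀))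

/-- The generators of `P₀` generate `C̄` over `R'` as well. [folklore] -/
theorem aeval_val_surjective_R' : Function.Surjective (aeval (R := R') P₀.val) := fun y => by
  obtain ⟨q, hq⟩ := P₀.aeval_val_surjective y
  exact ⟨MvPolynomial.map (algebraMap R (R')) q, by rw [aeval_map_algebraMap]; exact hq⟩

/-- The generators of `C̄` over `R'` with the same values as `P₀`. [folklore] -/
def Gq : Algebra.Generators (R') Cb (Fin n) :=
  Algebra.Generators.ofSurjective P₀.val (aeval_val_surjective_R' R' P₀)

/-- Same values. [folklore] -/
theorem Gq_val (i : Fin n) : (Gq R' P₀).val i = P₀.toGenerators.val i := rfl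

/-- The index set of all relations: the original `f_j` and the chart relations `b̃_{k,i}`.
[cite: StacksProject, Tag 07CP] -/
abbrev JJ (m₀ r : ℕ) (c : Fin r → ℕ) : Type := Fin m₀ ⊕ (Σ k : Fin r, Fin (c k))

variable {r : ℕ} {c : Fin r → ℕ} (ak : Fin r → MvPolynomial (Fin n) R)
  (bt : ∀ k : Fin r, Fin (c k) → MvPolynomial (Fin n) R)

/-- All the relations (Stacks: "we may and do assume that `E_k ⊂ {1, …, m}`" — we enlarge the list
of relations by the chart relations). [cite: StacksProject, Tag 07CP] -/
def FF : JJ m₀ r c → MvPolynomial (Fin n) R := Sum.elim P₀.relation fun ki => bt ki.1 ki.2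

/-- The positions `E_k` of the chart relations. [cite: StacksProject, Tag 07CP] -/
def ιι (k : Fin r) (i : Fin (c k)) : JJ m₀ r c := Sum.inr ⟨k, i⟩

omit [CommRing R] in
/-- `E_k` has `c_k` elements. [folklore] -/
theorem ιι_injective (k : Fin r) : Function.Injective (ιι (m₀ := m₀) (c := c) k) := by
  intro i i' h
  simp only [ιι, Sum.inr.injEq, Sigma.mk.injEq, heq_eq_eq, true_and] at h
  exact h

omit [Algebra (R') Cb] [IsScalarTower R (R') Cb] in
/-- The relation at position `ι_k(i)` is `b̃_{k,i}`. [folklore] -/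
theorem FF_ιι (k : Fin r) (i : Fin (c k)) : FF P₀ bt (ιι k i) = bt k i := rfl

omit [Algebra (R') Cb] [IsScalarTower R (R') Cb] in
/-- `ker(R[x] → C̄) ⊆ (all relations)`. [folklore] -/
theorem mem_span_FF_of_aeval_eq_zero (f : MvPolynomial (Fin n) R) (hf : aeval P₀.val f = 0) :
    f ∈ Ideal.span (Set.range (FF P₀ bt)) := by
  have hf' : f ∈ P₀.ker := by rw [P₀.ker_eq_ker_aeval_val, RingHom.mem_ker]; exact hf
  rw [← P₀.span_range_relation_eq_ker] at hf'
  refine Ideal.span_mono ?_ hf'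
  rintro _ ⟨j, rfl⟩
  exact ⟨Sum.inl j, rfl⟩

variable (h₀ : ∀ k : Fin r, JJ m₀ r c → Fin (c k) → MvPolynomial (Fin n) R)
  (g₀ : Fin r → JJ m₀ r c → MvPolynomial (Fin n) R)

/-- The normalised `h` ("If `ℓ ∈ E_k` we choose `h^j_{k,ℓ} = a_k δ_{ℓ,j}`"). [cite: StacksProject, Tag 07CP] -/
def hN (k : Fin r) (ℓ : JJ m₀ r c) : Fin (c k) → MvPolynomial (Fin n) R :=
  if hℓ : ∃ i, ιι k i = ℓ then Pi.single hℓ.choose (ak k) else h₀ k ℓ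

/-- The normalised `g` ("… and `g_{k,ℓ} = 0`"). [cite: StacksProject, Tag 07CP] -/
def gN (k : Fin r) (ℓ : JJ m₀ r c) : MvPolynomial (Fin n) R :=
  if ∃ i, ιι (m₀ := m₀) (c := c) k i = ℓ then 0 else g₀ k ℓ

/-- `h_{k, ι_k i} = a_k δ_i`. [cite: StacksProject, Tag 07CP] -/
theorem hN_ιι (k : Fin r) (i : Fin (c k)) : hN ak h₀ k (ιι k i) = Pi.single i (ak k) := by
  have hex : ∃ i', ιι (m₀ := m₀) k i' = ιι k i := ⟨i, rfl⟩
  rw [hN, dif_pos hex, (ιι_injective k hex.choose_spec : hex.choose = i)]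

/-- `g_{k, ι_k i} = 0`. [cite: StacksProject, Tag 07CP] -/
theorem gN_ιι (k : Fin r) (i : Fin (c k)) : gN g₀ k (ιι k i) = 0 := by
  rw [gN, if_pos ⟨i, rfl⟩]

variable (hrel₀ : ∀ k ℓ, ak k * FF P₀ bt ℓ = ∑ i, h₀ k ℓ i * bt k i + C (π ^ 2) * g₀ k ℓ)

omit [Algebra (R') Cb] [IsScalarTower R (R') Cb] in
include hrel₀ in
/-- Relations (4) with the normalised coefficients. [cite: StacksProject, Tag 07CP] -/
theorem h4N (k : Fin r) (ℓ : JJ m₀ r c) :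
    ak k * FF P₀ bt ℓ = ∑ i, hN ak h₀ k ℓ i * FF P₀ bt (ιι k i) + C (π ^ 2) * gN g₀ k ℓ := by
  by_cases hℓ : ∃ i, ιι k i = ℓ
  · obtain ⟨i, rfl⟩ := hℓ
    rw [hN_ιι, gN_ιι, mul_zero, add_zero, Finset.sum_eq_single i]
    · rw [Pi.single_eq_same]
    · intro i' _ hi'
      rw [Pi.single_eq_of_ne hi', zero_mul]
    · intro hi; exact absurd (Finset.mem_univ i) hi
  · rw [hN, dif_neg hℓ, gN, if_neg hℓ]
    exact hrel₀ k ℓ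

/-! ### (5): the cocycle defects are killed by powers of `a_k` -/

variable (hkerR' : RingHom.ker (algebraMap R R') = Ideal.span {π ^ 2})
  (ach : Fin r → Cb) (ex : Fin r → ℕ) (hak : ∀ k, aeval P₀.val (ak k) = ach k ^ (ex k + 1))
  (bch : ∀ k, Fin (c k) → (Gq R' P₀).toExtension.ker)
  (hred : ∀ k i, MvPolynomial.map (algebraMap R (R')) (bt k i) = (bch k i).val)
  (Bch : ∀ k, Module.Basis (Fin (c k)) (Localization.Away (ach k)) (Stacks07EZ.LocCot (Gq R' P₀) (ach k)))
  (hBch : ∀ k i, Bch k i = (1 : Localization.Away (ach k)) ⊗ₜ[Cb] Algebra.Extension.Cotangent.mk (bch k i))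

omit [Algebra (R') Cb] [IsScalarTower R (R') Cb] in
include hrel₀ in
/-- `∑_j c_j f_{ι_k j} = π² Q`. [cite: StacksProject, Tag 07CP] -/
theorem sum_cc_mul_FF (k k' : Fin r) (ℓ : JJ m₀ r c) :
    ∑ j, cc ιι ak (hN ak h₀) k k' ℓ j * FF P₀ bt (ιι k j) =
      C (π ^ 2) * (-(ak k' * gN g₀ k ℓ) + ak k * gN g₀ k' ℓ +
        ∑ j', hN ak h₀ k' ℓ j' * gN g₀ k (ιι k' j')) := by
  have e1 := h4N π P₀ ak bt h₀ g₀ hrel₀ k ℓ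
  have e2 := h4N π P₀ ak bt h₀ g₀ hrel₀ k' ℓ
  have e3 := fun j' => h4N π P₀ ak bt h₀ g₀ hrel₀ k (ιι k' j')
  -- `∑_j cc_j F_j = a_{k'} ∑ h F - ∑_{j'} h' (∑_j h F)`
  have hsplit : ∑ j, cc ιι ak (hN ak h₀) k k' ℓ j * FF P₀ bt (ιι k j) =
      ak k' * ∑ j, hN ak h₀ k ℓ j * FF P₀ bt (ιι k j) -
        ∑ j', hN ak h₀ k' ℓ j' * ∑ j, hN ak h₀ k (ιι k' j') j * FF P₀ bt (ιι k j) := by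
    simp only [cc, sub_mul, Finset.sum_sub_distrib, Finset.mul_sum, Finset.sum_mul]
    congr 1
    · exact Finset.sum_congr rfl fun j _ => by ring
    · rw [Finset.sum_comm]
      exact Finset.sum_congr rfl fun j _ => Finset.sum_congr rfl fun j' _ => by ring
  have hs1 : ∑ j, hN ak h₀ k ℓ j * FF P₀ bt (ιι k j) = ak k * FF P₀ bt ℓ - C (π ^ 2) * gN g₀ k ℓ := by
    rw [e1]; ring
  have hs3 : ∀ j', ∑ j, hN ak h₀ k (ιι k' j') j * FF P₀ bt (ιι k j) =
      ak k * FF P₀ bt (ιι k' j') - C (π ^ 2) * gN g₀ k (ιι k' j') := fun j' => by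
    rw [e3 j']; ring
  rw [hsplit, hs1]
  simp_rw [hs3]
  have hs2 : ∑ j', hN ak h₀ k' ℓ j' * (ak k * FF P₀ bt (ιι k' j') - C (π ^ 2) * gN g₀ k (ιι k' j')) =
      ak k * (ak k' * FF P₀ bt ℓ - C (π ^ 2) * gN g₀ k' ℓ) -
        C (π ^ 2) * ∑ j', hN ak h₀ k' ℓ j' * gN g₀ k (ιι k' j') := by
    rw [e2, add_sub_cancel_right, Finset.mul_sum, Finset.mul_sum, ← Finset.sum_sub_distrib]
    exact Finset.sum_congr rfl fun j' _ => by ring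
  rw [hs2]
  ring

include hrel₀ hak hred hBch hkerR' in
set_option backward.isDefEq.respectTransparency false in
/-- **(5)**: `a_k^N c_j ∈ (f_1, …, f_m)` (Stacks: "Since `(Ī_k/Ī_k²)_{a_k}` is free on `f_j`,
`j ∈ E_k` we see that `a_{k'} h^j_{k,ℓ} - ∑ h^{j'}_{k',ℓ} h^j_{k,j'}` is zero in `C̄_{a_k}` …
Hence we can find a large integer `N` …"). [cite: StacksProject, Tag 07CP] -/
theorem h5N (k k' : Fin r) (ℓ : JJ m₀ r c) (j : Fin (c k)) :
    ∃ N, ak k ^ N * cc ιι ak (hN ak h₀) k k' ℓ j ∈ Ideal.span (Set.range (FF P₀ bt)) := by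
  let red : MvPolynomial (Fin n) R →+* (Gq R' P₀).toExtension.Ring :=
    MvPolynomial.map (algebraMap R (R'))
  have hredC : red (C (π ^ 2)) = 0 := by
    change MvPolynomial.map _ (C (π ^ 2)) = (0 : MvPolynomial (Fin n) (R'))
    have h0 : algebraMap R R' (π ^ 2) = 0 := by
      rw [← RingHom.mem_ker, hkerR']; exact Ideal.mem_span_singleton_self _
    rw [map_C, h0, C_0]
  have hred' : ∀ i, ((bch k i).val : (Gq R' P₀).toExtension.Ring) = red (bt k i) :=
    fun i => (hred k i).symm
  have hsum : ∑ j, red (cc ιι ak (hN ak h₀) k k' ℓ j) * (bch k j).val = 0 := by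
    have := congrArg red (sum_cc_mul_FF π P₀ ak bt h₀ g₀ hrel₀ k k' ℓ)
    rw [map_mul, hredC, zero_mul, map_sum] at this
    rw [← this]
    refine Finset.sum_congr rfl fun j _ => ?_
    rw [map_mul, FF_ιι, hred']
  obtain ⟨N, hN'⟩ := Stacks07CP.exists_pow_mul_eq_zero_of_sum_eq_zero (Gq R' P₀) (ach k) (bch k)
    (Bch k) (hBch k) _ hsum j
  have haev : algebraMap (Gq R' P₀).toExtension.Ring Cb (red (cc ιι ak (hN ak h₀) k k' ℓ j)) =
      aeval P₀.val (cc ιι ak (hN ak h₀) k k' ℓ j) :=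
    Stacks07CP.algebraMap_map_eq_aeval (Gq R' P₀) P₀.toGenerators (Gq_val R' P₀) _
  rw [haev] at hN'
  refine ⟨N, mem_span_FF_of_aeval_eq_zero P₀ bt _ ?_⟩
  rw [map_mul, map_pow, hak, ← pow_mul, add_mul, one_mul, pow_add, mul_assoc, hN', mul_zero]

variable (hR : ∀ s : R, π ^ 2 * s = 0 → π * s = 0)
  (hsm : ∀ k, Algebra.FormallySmooth (R') (Localization.Away (ach k)))
  (hcover : Algebra.smoothLocus (R') Cb ⊆
    ⋃ k, (↑(PrimeSpectrum.basicOpen (ach k)) : Set (PrimeSpectrum Cb)))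

include hred hsm hBch in
set_option backward.isDefEq.respectTransparency false in
/-- **Some maximal minor of `(∂b̃_{k,j}/∂x_i)` is not in a prime avoiding `a_k`** (from the left
inverse of the split injection `(Ī/Ī²)_{a_k} → ⊕ C̄_{a_k} dx_i`, Lemma 07DQ (2): the `c × c` minors
generate an ideal containing a power of `a_k`). This is the Jacobian input replacing Stacks' "smooth of
relative dimension `n - |E_k|`". [cite: StacksProject, Tag 07CP] -/
theorem exists_minor_notMem (k : Fin r) (𝔯 : Ideal Cb) [𝔯.IsPrime] (ha : ach k ∉ 𝔯) :
    ∃ p : Fin (c k) → Fin n, Function.Injective p ∧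
      aeval P₀.val (minor (FF P₀ bt) ιι k p).det ∉ 𝔯 := by
  classical
  haveI := hsm k
  obtain ⟨E, ψ, hψ⟩ := Stacks07EZ.exists_matrix_mul_jacobian (Gq R' P₀) (ach k) (bch k) (Bch k) (hBch k)
  let ψM : Matrix (Fin (c k)) (Fin n) Cb := Matrix.of ψ
  let JM : Matrix (Fin n) (Fin (c k)) Cb :=
    Matrix.of fun i j => aeval (Gq R' P₀).val (pderiv i (bch k j).val)
  have hmul : ψM * JM = (ach k ^ E) • (1 : Matrix (Fin (c k)) (Fin (c k)) Cb) := by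
    ext k₁ j
    rw [Matrix.mul_apply, Matrix.smul_apply, Matrix.one_apply, smul_eq_mul, mul_ite, mul_one,
      mul_zero]
    simp only [ψM, JM, Matrix.of_apply]
    rw [hψ k₁ j]
    simp only [eq_comm]
  have hpow := pow_eq_sum_minors_of_mul_eq ψM JM (ach k ^ E) hmul
  have hdet : ∀ p : Fin (c k) → Fin n, (Matrix.of fun i j => JM (p i) j).det =
      aeval P₀.val (minor (FF P₀ bt) ιι k p).det := by
    intro p
    rw [AlgHom.map_det, AlgHom.mapMatrix_apply]
    congr 1
    ext i j
    simp only [JM, Matrix.of_apply, Matrix.map_apply, minor, FF_ιι]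
    rw [← hred, pderiv_map]
    exact MvPolynomial.aeval_map_algebraMap (R') P₀.val _
  have hnot : (ach k ^ E) ^ (c k) ∉ 𝔯 := fun h =>
    ha (‹𝔯.IsPrime›.mem_of_pow_mem _ (‹𝔯.IsPrime›.mem_of_pow_mem _ h))
  rw [hpow] at hnot
  obtain ⟨p, -, hp⟩ : ∃ p ∈ (Finset.univ : Finset (Fin (c k) → Fin n)),
      (∏ i, ψM i (p i)) * (Matrix.of fun i j => JM (p i) j).det ∉ 𝔯 := by
    by_contra hall
    exact hnot (Ideal.sum_mem _ fun p hp =>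
      Classical.by_contradiction fun h => hall ⟨p, hp, h⟩)
  rw [hdet p] at hp
  have hp' : aeval P₀.val (minor (FF P₀ bt) ιι k p).det ∉ 𝔯 := fun h =>
    hp (Ideal.mul_mem_left _ _ h)
  refine ⟨p, fun i i' hii' => ?_, hp'⟩
  by_contra hne
  apply hp'
  have h0 : (minor (FF P₀ bt) ιι k p).det = 0 :=
    Matrix.det_zero_of_row_eq hne (funext fun j => by simp only [minor, Matrix.of_apply, hii'])
  rw [h0, map_zero]
  exact Ideal.zero_mem _

variable [Algebra.FinitePresentation (R') Cb]

include hrel₀ hak hred hBch hR hsm hcover hkerR' in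
set_option maxHeartbeats 800000 in
/-- **(c) of Stacks 07CP** in the form: `ε` maps `H_{C̄/R'}` into `H_{D/R}` modulo `π`, i.e. every
lift `d` of `ε(x)` with `C̄_x` smooth lies in `H_{D/R}` (Stacks: "let `𝔮 ⊂ D` be a prime containing
`π` lying over a prime where `R/π²R → C̄` is smooth. Then `a_k ∉ 𝔮` for some `k` by (1) … this
will prove (c)"). [cite: StacksProject, Tag 07CP] -/
theorem mem_singularIdeal_of_eps (x : Cb) (hx : Algebra.FormallySmooth (R') (Localization.Away x))
    (d : Dalg π (FF P₀ bt) ιι ak (hN ak h₀) (gN g₀))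
    (hd : Ideal.Quotient.mk (πD π (FF P₀ bt) ιι ak (hN ak h₀) (gN g₀)) d =
      eps π (FF P₀ bt) ιι ak (hN ak h₀) (gN g₀) P₀.val P₀.aeval_val_surjective
        (mem_span_FF_of_aeval_eq_zero P₀ bt) x) :
    d ∈ singularIdeal R (Dalg π (FF P₀ bt) ιι ak (hN ak h₀) (gN g₀)) := by
  classical
  have h4 := h4N π P₀ ak bt h₀ g₀ hrel₀
  have hb : algebraMap R (Dalg π (FF P₀ bt) ιι ak (hN ak h₀) (gN g₀)) π ∈ singularIdeal R (Dalg π (FF P₀ bt) ιι ak (hN ak h₀) (gN g₀)) :=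
    algebraMap_pi_mem_singularIdeal π (FF P₀ bt) ιι ak (hN ak h₀) (gN g₀) h4
  by_contra hdH
  -- a prime `𝔮 ⊇ H_D` with `d ∉ 𝔮`
  obtain ⟨𝔮, ⟨hH𝔮, h𝔮⟩, hd𝔮⟩ :
      ∃ 𝔮 ∈ {J : Ideal (Dalg π (FF P₀ bt) ιι ak (hN ak h₀) (gN g₀)) | singularIdeal R (Dalg π (FF P₀ bt) ιι ak (hN ak h₀) (gN g₀)) ≤ J ∧ J.IsPrime}, d ∉ 𝔮 := by
    have hrad : d ∉ (singularIdeal R (Dalg π (FF P₀ bt) ιι ak (hN ak h₀) (gN g₀))).radical := by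
      rwa [(isRadical_singularIdeal (R := R) (A := Dalg π (FF P₀ bt) ιι ak (hN ak h₀) (gN g₀))).radical]
    rw [Ideal.radical_eq_sInf, Submodule.mem_sInf] at hrad
    by_contra hne
    exact hrad fun J hJ => Classical.by_contradiction fun hdJ => hne ⟨J, hJ, hdJ⟩
  haveI := h𝔮
  have hπ𝔮 : algebraMap R (Dalg π (FF P₀ bt) ιι ak (hN ak h₀) (gN g₀)) π ∈ 𝔮 := hH𝔮 hb
  have hπD : πD π (FF P₀ bt) ιι ak (hN ak h₀) (gN g₀) ≤ 𝔮 :=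
    (Ideal.span_singleton_le_iff_mem _).mpr hπ𝔮
  -- `𝔮̄ ⊂ D/πD` and `𝔯 ⊂ C̄`
  let 𝔮b : Ideal (Dalg π (FF P₀ bt) ιι ak (hN ak h₀) (gN g₀) ⧸ πD π (FF P₀ bt) ιι ak (hN ak h₀) (gN g₀)) := 𝔮.map (Ideal.Quotient.mk _)
  haveI h𝔮b : 𝔮b.IsPrime :=
    Ideal.map_isPrime_of_surjective Ideal.Quotient.mk_surjective (by rwa [Ideal.mk_ker])
  have hmem𝔮b : ∀ y : Dalg π (FF P₀ bt) ιι ak (hN ak h₀) (gN g₀), Ideal.Quotient.mk (πD π (FF P₀ bt) ιι ak (hN ak h₀) (gN g₀)) y ∈ 𝔮b ↔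
      y ∈ 𝔮 := fun y => Ideal.mem_quotient_iff_mem hπD
  let ε := eps π (FF P₀ bt) ιι ak (hN ak h₀) (gN g₀) P₀.val P₀.aeval_val_surjective
    (mem_span_FF_of_aeval_eq_zero P₀ bt)
  let 𝔯 : Ideal Cb := 𝔮b.comap ε
  haveI h𝔯 : 𝔯.IsPrime := Ideal.IsPrime.comap ε
  have hmem𝔯 : ∀ q : MvPolynomial (Fin n) R,
      aeval P₀.val q ∈ 𝔯 ↔ Ideal.Quotient.mk (idealD π (FF P₀ bt) ιι ak (hN ak h₀) (gN g₀)) (inc q) ∈ 𝔮 :=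
    fun q => by
      change ε (aeval P₀.val q) ∈ 𝔮b ↔ _
      rw [eps_aeval, toDmod₀_apply, hmem𝔮b]
  -- `x ∉ 𝔯`
  have hx𝔯 : x ∉ 𝔯 := fun h => by
    change ε x ∈ 𝔮b at h
    rw [← hd, hmem𝔮b] at h
    exact hd𝔮 h
  -- `𝔯` lies in the smooth locus, hence in a chart
  have h𝔯sm : (⟨𝔯, h𝔯⟩ : PrimeSpectrum Cb) ∈ Algebra.smoothLocus (R') Cb :=
    (Algebra.basicOpen_subset_smoothLocus_iff (R := R') (f := x)).mpr hx hx𝔯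
  obtain ⟨k, hk⟩ : ∃ k, ach k ∉ 𝔯 := by
    have := hcover h𝔯sm
    simp only [Set.mem_iUnion] at this
    obtain ⟨k, hk⟩ := this
    exact ⟨k, hk⟩
  -- `ã_k ∉ 𝔮`
  have hak𝔮 : Ideal.Quotient.mk (idealD π (FF P₀ bt) ιι ak (hN ak h₀) (gN g₀)) (inc (ak k)) ∉ 𝔮 :=
    fun h => hk (h𝔯.mem_of_pow_mem _ (by rw [← hak k]; exact (hmem𝔯 _).mpr h))
  -- a minor `∉ 𝔮`
  obtain ⟨p, hp, hdet⟩ := exists_minor_notMem R' P₀ bt ach bch hred Bch hBch hsm k 𝔯 hk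
  have hdet𝔮 : Ideal.Quotient.mk (idealD π (FF P₀ bt) ιι ak (hN ak h₀) (gN g₀))
      (inc (minor (FF P₀ bt) ιι k p).det) ∉ 𝔮 := fun h => hdet ((hmem𝔯 _).mpr h)
  -- but `det · ã_k^{N+1} ∈ H_D ⊆ 𝔮`
  have hmem := hH𝔮 (minor_mul_pow_mem_singularIdeal π (FF P₀ bt) ιι ak (hN ak h₀) (gN g₀) h4 k p hp
    (hN_ιι ak h₀) (gN_ιι g₀) (h5N π R' P₀ ak bt h₀ g₀ hrel₀ hkerR' ach ex hak bch hred Bch hBch) hR)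
  rcases h𝔮.mem_or_mem hmem with h | h
  · exact hdet𝔮 h
  · exact hak𝔮 (h𝔮.mem_of_pow_mem _ h)

end Setup

open Stacks07CPGen in
/-- **Stacks, Lemma 07CP (the lifting lemma)**, general case. Let `R` be a Noetherian ring, `Λ` an
`R`-algebra, `π ∈ R` with `Ann_R(π) = Ann_R(π²)` and `Ann_Λ(π) = Ann_Λ(π²)`, and
`R/π²R → C̄ → Λ/π²Λ` `R`-algebra maps with `C̄` of finite presentation (rendered with an arbitrary
`R' ≅ R/π²R`: `R → R'` surjective with kernel `(π²)`, and `Λ/I`, `I = π²Λ`). Then there are a finitely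
presented `R`-algebra `D`, an `R`-algebra map `δ : D → Λ` and `ε : C̄ → D/πD` making the diagram
(16.6.0.1) commute, such that (b) `R → D` is smooth at every prime not containing `π` — rendered:
`π ∈ H_{D/R}` — and (c) `R → D` is smooth at every prime `𝔮 ∋ π` lying over a prime of `C̄` where
`R/π²R → C̄` is smooth — rendered (equivalently, given (b) and that `H_{D/R}` is radical): for every
`x ∈ C̄` with `C̄_x` (formally) smooth over `R/π²R`, every lift of `ε(x)` lies in `H_{D/R}`.
(Conclusion (d) of the printed lemma, smoothness of `C̄/πC̄ → D/πD`, is not included.) The proof is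
the printed one (charts with free conormal module, the relations (4), the algebra
`D = R[x, z]/(f_j - π z_j, p_{k,ℓ})`, `D_π ≅ R_π[x]`, the algebras `D_k`), except that the
smoothness of `D_k` at `𝔮_k` is obtained from an explicit Jacobian (standard smoothness after
inverting `det(∂f_j/∂x_i)_{j ∈ E_k, i ∈ I} · a_k`) instead of the fibrewise criterion.
[cite: StacksProject, Tag 07CP] -/
theorem Stacks07CP_general {R Λ : Type u} [CommRing R] [CommRing Λ] [Algebra R Λ]
    [IsNoetherianRing R] (π : R) (hR : ∀ s : R, π ^ 2 * s = 0 → π * s = 0)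
    (hΛ : ∀ x : Λ, algebraMap R Λ π ^ 2 * x = 0 → algebraMap R Λ π * x = 0)
    (R' : Type u) [CommRing R'] [Algebra R R'] (hR' : Function.Surjective (algebraMap R R'))
    (hkerR' : RingHom.ker (algebraMap R R') = Ideal.span {π ^ 2})
    (I : Ideal Λ) (hI : I = Ideal.span {algebraMap R Λ π ^ 2})
    (Cb : Type u) [CommRing Cb] [Algebra R Cb] [Algebra R' Cb] [IsScalarTower R R' Cb]
    [Algebra.FinitePresentation R' Cb] (γ : Cb →ₐ[R] Λ ⧸ I) :
    ∃ (D : Type u) (_ : CommRing D) (_ : Algebra R D), Algebra.FinitePresentation R D ∧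
      ∃ (δ : D →ₐ[R] Λ) (ε : Cb →ₐ[R] D ⧸ Ideal.span {algebraMap R D π}),
        (∀ (x : Cb) (d : D) (l : Λ), Ideal.Quotient.mk _ d = ε x → Ideal.Quotient.mk _ l = γ x →
          Ideal.Quotient.mk (Ideal.span {algebraMap R Λ π}) (δ d) =
            Ideal.Quotient.mk (Ideal.span {algebraMap R Λ π}) l) ∧
        algebraMap R D π ∈ singularIdeal R D ∧
        ∀ x : Cb, Algebra.FormallySmooth R' (Localization.Away x) →
          ∀ d : D, Ideal.Quotient.mk _ d = ε x → d ∈ singularIdeal R D := by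
  classical
  subst hI
  haveI : Algebra.FinitePresentation R R' := by
    refine Algebra.FinitePresentation.of_surjective (f := Algebra.ofId R R') hR' ?_
    rw [show RingHom.ker (Algebra.ofId R R').toRingHom = RingHom.ker (algebraMap R R') from rfl, hkerR']
    exact Submodule.fg_span_singleton _
  haveI : Algebra.FinitePresentation R Cb := Algebra.FinitePresentation.trans R R' Cb
  haveI : IsNoetherianRing R' := isNoetherianRing_of_surjective R R' (algebraMap R R') hR'
  obtain ⟨n, m₀, ⟨P₀⟩⟩ := Algebra.Presentation.exists_presentation_fin R Cb
  -- charts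
  obtain ⟨t, ht, hcover⟩ := Stacks07CP.exists_finite_charts (Gq R' P₀)
  choose hsm cch bch Bch hBch using ht
  let e : Fin t.card ≃ {a // a ∈ t} := t.equivFin.symm
  let ach : Fin t.card → Cb := fun k => (e k).1
  have hmem : ∀ k, ach k ∈ t := fun k => (e k).2
  -- lifted relations
  have hlift := fun k => Stacks07CP.exists_lift_relations (Gq R' P₀) (ach k) (bch (ach k) (hmem k))
    (Bch (ach k) (hmem k)) (hBch (ach k) (hmem k)) π (R := R) hR'
    hkerR' P₀.toGenerators (Gq_val R' P₀)
  choose ak₀ ex bt hak₀ hbt0 hred hrel using hlift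
  choose sa hsa using fun k => P₀.aeval_val_surjective (ach k)
  let ak : Fin t.card → MvPolynomial (Fin n) R := fun k => ak₀ k * sa k
  have hak : ∀ k, aeval P₀.val (ak k) = ach k ^ (ex k + 1) := fun k => by
    change aeval P₀.val (ak₀ k * sa k) = _
    rw [map_mul, hak₀, hsa, pow_succ]
  have hFF0 : ∀ ℓ : JJ m₀ t.card (fun k => cch (ach k) (hmem k)), aeval P₀.val (FF P₀ bt ℓ) = 0 := by
    rintro (j | ⟨k, i⟩)
    · exact P₀.aeval_val_relation j
    · exact hbt0 k i
  choose h₀' g₀' hrel' using fun k ℓ => hrel k (FF P₀ bt ℓ) (hFF0 ℓ)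
  let h₀ : ∀ k : Fin t.card, JJ m₀ t.card (fun k => cch (ach k) (hmem k)) →
      Fin (cch (ach k) (hmem k)) → MvPolynomial (Fin n) R := fun k ℓ i => h₀' k ℓ i * sa k
  let g₀ : Fin t.card → JJ m₀ t.card (fun k => cch (ach k) (hmem k)) → MvPolynomial (Fin n) R :=
    fun k ℓ => g₀' k ℓ * sa k
  have hrel₀ : ∀ k ℓ, ak k * FF P₀ bt ℓ = ∑ i, h₀ k ℓ i * bt k i + C (π ^ 2) * g₀ k ℓ := by
    intro k ℓ
    change ak₀ k * sa k * _ = ∑ i, h₀' k ℓ i * sa k * bt k i + C (π ^ 2) * (g₀' k ℓ * sa k)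
    rw [mul_right_comm, hrel', add_mul, Finset.sum_mul]
    congr 1
    · exact Finset.sum_congr rfl fun i _ => by ring
    · ring
  have h4 := h4N π P₀ ak bt h₀ g₀ hrel₀
  -- `λ_i` and `μ_j`
  choose lam hlam using fun i => Ideal.Quotient.mk_surjective (γ (P₀.val i))
  have hkey : (Ideal.Quotient.mkₐ R (Ideal.span {algebraMap R Λ π ^ 2})).comp (aeval lam) =
      γ.comp (aeval P₀.val) := by
    refine MvPolynomial.algHom_ext fun i => ?_
    rw [AlgHom.comp_apply, AlgHom.comp_apply, aeval_X, aeval_X, Ideal.Quotient.mkₐ_eq_mk, hlam]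
  have hμex : ∀ j : JJ m₀ t.card (fun k => cch (ach k) (hmem k)),
      ∃ μ : Λ, aeval lam (FF P₀ bt j) = algebraMap R Λ π ^ 2 * μ := fun j => by
    have h1 : aeval lam (FF P₀ bt j) ∈ Ideal.span {algebraMap R Λ π ^ 2} := by
      rw [← Ideal.Quotient.eq_zero_iff_mem, ← Ideal.Quotient.mkₐ_eq_mk R, ← AlgHom.comp_apply, hkey,
        AlgHom.comp_apply, hFF0, map_zero]
    rw [Ideal.mem_span_singleton'] at h1
    obtain ⟨μ, hμ⟩ := h1
    exact ⟨μ, by rw [← hμ, mul_comm]⟩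
  choose μ hμ using hμex
  refine ⟨Dalg π (FF P₀ bt) ιι ak (hN ak h₀) (gN g₀), inferInstance, inferInstance, inferInstance,
    toΛ π (FF P₀ bt) ιι ak (hN ak h₀) (gN g₀) h4 lam μ hμ hΛ,
    eps π (FF P₀ bt) ιι ak (hN ak h₀) (gN g₀) P₀.val P₀.aeval_val_surjective
      (mem_span_FF_of_aeval_eq_zero P₀ bt), ?_,
    algebraMap_pi_mem_singularIdeal π (FF P₀ bt) ιι ak (hN ak h₀) (gN g₀) h4, ?_⟩
  · -- the diagram
    intro x d l hd hl
    obtain ⟨q, rfl⟩ := P₀.aeval_val_surjective x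
    rw [eps_aeval, toDmod₀_apply, Ideal.Quotient.eq, Ideal.mem_span_singleton'] at hd
    obtain ⟨w, hw⟩ := hd
    have hd' : d = Ideal.Quotient.mk _ (inc q) + w * algebraMap R _ π := by rw [hw]; ring
    have hq : aeval lam q - l ∈ Ideal.span {algebraMap R Λ π} := by
      have h1 : Ideal.Quotient.mk (Ideal.span {algebraMap R Λ π ^ 2}) (aeval lam q) =
          Ideal.Quotient.mk _ l := by
        rw [hl, ← Ideal.Quotient.mkₐ_eq_mk R, ← AlgHom.comp_apply, hkey, AlgHom.comp_apply]
      rw [Ideal.Quotient.eq, Ideal.mem_span_singleton'] at h1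
      obtain ⟨v, hv⟩ := h1
      rw [← hv, pow_two, ← mul_assoc]
      exact Ideal.mul_mem_left _ _ (Ideal.mem_span_singleton_self _)
    rw [Ideal.Quotient.eq, hd', map_add, map_mul, AlgHom.commutes, toΛ_mk, evΛ_inc, add_sub_right_comm]
    exact Ideal.add_mem _ hq (Ideal.mul_mem_left _ _ (Ideal.mem_span_singleton_self _))
  · -- (c)
    intro x hx d hd
    have hcover' : Algebra.smoothLocus (R') Cb ⊆
        ⋃ k, (↑(PrimeSpectrum.basicOpen (ach k)) : Set (PrimeSpectrum Cb)) := by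
      intro y hy
      have := hcover hy
      simp only [Set.mem_iUnion] at this
      obtain ⟨a, ha, hya⟩ := this
      refine Set.mem_iUnion.mpr ⟨e.symm ⟨a, ha⟩, ?_⟩
      have : ach (e.symm ⟨a, ha⟩) = a := by
        change (e (e.symm ⟨a, ha⟩)).1 = a
        rw [Equiv.apply_symm_apply]
      rw [this]
      exact hya
    exact mem_singularIdeal_of_eps π R' P₀ ak bt h₀ g₀ hrel₀ hkerR' ach ex hak
      (fun k => bch (ach k) (hmem k)) hred (fun k => Bch (ach k) (hmem k))
      (fun k => hBch (ach k) (hmem k)) hR (fun k => (hsm (ach k) (hmem k)).1) hcover' x hx d hd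

end Stacks07CPGen

end Literature.AlgebraicGeometry.Resolution

end
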